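import Mathlib.NumberTheory.Harmonic.Bounds
import Mathlib.Analysis.SpecialFunctions.Trigonometric.Series
import Literature.MathematicalPhysics.QuantumLattice.LatticeTori
import HarnessLib

/-!
# A logarithmic test potential on the two-dimensional discrete torus

Trunk T-QLATTICE (family `hubbard`; consumer: the Koma–Tasaki bound
`Literature.MathematicalPhysics.QuantumLattice.koma_tasaki_2d`). The last step of Koma–Tasaki's proof of the power-law decay of
correlations in two dimensions (PRL 68 (1992) 3248, eqs. (11)–(12), following McBryan–Spencer)
needs a real site function `φ` on the torus `(ℤ/Lℤ)²` with a *large* difference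
`φ_x - φ_y ≈ q log |x - y|` but a *small* Dirichlet-type energy
`Σ_{u ∼ v} (cosh(φ_u - φ_v) - 1) ≲ q² log |x - y|`, uniformly in `L`. Koma–Tasaki take the
solution of a lattice Poisson equation; any test function with these two properties does, and we
use the explicit radial one `φ_u = q · H(min(dist(u, y), D))`, `D = dist(x, y)`, `H` the harmonic
numbers (so that `φ_x - φ_y = q H(D) ≥ q log(1 + D)` and nearest-neighbour differences are
exactly `q / (1 + min)` or `0`).

Main result: `exists_torusTestPotential` — for `L ≥ 1`, `x, y ∈ (ℤ/Lℤ)²` and `0 ≤ q ≤ 1`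
there is `φ` with `φ y = 0`, `φ x = q H(dist(x, y))` and
`Σ_u Σ_v [u ∼ v] 2 (cosh(φ_u - φ_v) - 1) ≤ 128 q² H(dist(x, y))`.

Ingredients (all elementary): the torus norm is `1`-Lipschitz along edges
(`torusNorm_add_single_le`), every site has at most `2d` neighbours (`card_filter_torusGraph_adj_le`),
the `ℓ^∞`-sphere of radius `r` in `(ℤ/Lℤ)²` has at most `4 (2r + 1)` sites
(`card_filter_torusNorm_eq_le`), whence `Σ_{dist(u,y) < D} (1 + dist(u, y))^{-2} ≤ 8 H(D)`
(`sum_indicator_inv_sq_le`), and `cosh s - 1 ≤ s²` for `|s| ≤ 1`.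

Sources: T. Koma, H. Tasaki, PRL 68 (1992) 3248, eqs. (11)–(12); O. A. McBryan, T. Spencer,
Commun. Math. Phys. 53 (1977) 299.

## Mathlib search

Uses `harmonic`, `harmonic_succ`, `log_add_one_le_harmonic` (not needed here but by the
consumer), `Real.cosh_le_exp_half_sq`, `Real.abs_exp_sub_one_le`, `ZMod.val_add`, `ZMod.neg_val`,
`Finset.sum_fiberwise_of_maps_to'`. Mathlib has no discrete-torus potential theory.
-/

noncomputable section

namespace Literature.MathematicalPhysics.QuantumLattice

open Finset Literature.Probability.LatticeModels

variable {d : ℕ}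

/-! ### The torus norm along edges -/

/-- The coordinate function of the torus norm, `a ↦ min(a, L - a)` on representatives, changes by
at most `1` under `a ↦ a + 1 (mod L)`. [folklore] -/
theorem min_val_add_one_le (L : ℕ) [NeZero L] (a : ZMod L) :
    min (a + 1).val (L - (a + 1).val) ≤ min a.val (L - a.val) + 1 ∧
      min a.val (L - a.val) ≤ min (a + 1).val (L - (a + 1).val) + 1 := by
  have ha : a.val < L := ZMod.val_lt a
  rcases Nat.lt_or_ge 1 L with hL | hL
  · have h1 : (1 : ZMod L).val = 1 := by
      rw [ZMod.val_one_eq_one_mod, Nat.mod_eq_of_lt hL]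
    have hv : (a + 1).val = (a.val + 1) % L := by rw [ZMod.val_add, h1]
    rcases Nat.lt_or_ge (a.val + 1) L with hlt | hge
    · rw [Nat.mod_eq_of_lt hlt] at hv
      omega
    · have hEq : a.val + 1 = L := le_antisymm ha hge
      rw [hEq, Nat.mod_self] at hv
      omega
  · have hL1 : L = 1 := le_antisymm hL (Nat.one_le_iff_ne_zero.mpr (NeZero.ne L))
    have hb : (a + 1).val < L := ZMod.val_lt _
    omega

/-- The torus norm is `1`-Lipschitz along the edges of the torus graph:
`‖z + eᵢ‖ ≤ ‖z‖ + 1` and `‖z‖ ≤ ‖z + eᵢ‖ + 1`. (Friedli–Velenik 2017, §3.1.) [folklore] -/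
theorem torusNorm_add_single_le (L : ℕ) [NeZero L] (z : TorusSite d L) (i : Fin d) :
    torusNorm (z + Pi.single i 1) ≤ torusNorm z + 1 ∧
      torusNorm z ≤ torusNorm (z + Pi.single i 1) + 1 := by
  constructor
  · refine Finset.sup_le fun j _ => ?_
    by_cases hj : j = i
    · subst hj
      have h := (min_val_add_one_le L (z j)).1
      have hle : min (z j).val (L - (z j).val) ≤ torusNorm z :=
        Finset.le_sup (f := fun k => min (z k).val (L - (z k).val)) (mem_univ j)
      simp only [Pi.add_apply, Pi.single_eq_same]
      exact h.trans (by simpa [torusNorm] using Nat.add_le_add_right hle 1)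
    · have hle : min (z j).val (L - (z j).val) ≤ torusNorm z :=
        Finset.le_sup (f := fun k => min (z k).val (L - (z k).val)) (mem_univ j)
      simp only [Pi.add_apply, Pi.single_eq_of_ne hj, add_zero]
      exact hle.trans (Nat.le_succ _)
  · set w : TorusSite d L := z + Pi.single i 1 with hw
    refine Finset.sup_le fun j _ => ?_
    have hle : min (w j).val (L - (w j).val) ≤ torusNorm w :=
      Finset.le_sup (f := fun k => min (w k).val (L - (w k).val)) (mem_univ j)
    by_cases hj : j = i
    · subst hj
      have h := (min_val_add_one_le L (z j)).2
      have hwj : w j = z j + 1 := by simp [hw]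
      rw [hwj] at hle
      exact h.trans (Nat.add_le_add_right hle 1)
    · have hwj : w j = z j := by simp [hw, Pi.single_eq_of_ne hj]
      rw [hwj] at hle
      exact hle.trans (Nat.le_succ _)

/-- Along an edge `a ∼ b` of the torus graph the distances to any site `y` differ by at most `1`.
(Friedli–Velenik 2017, §3.1.) [folklore] -/
theorem torusDist_le_of_adj (L : ℕ) [NeZero L] {a b : TorusSite d L}
    (h : (torusGraph d L).Adj a b) (y : TorusSite d L) :
    torusDist a y ≤ torusDist b y + 1 ∧ torusDist b y ≤ torusDist a y + 1 := by
  rw [torusGraph_adj_iff] at h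
  rcases h.2 with ⟨i, hi⟩ | ⟨i, hi⟩
  · have key : b - y = (a - y) + Pi.single i 1 := by rw [hi]; abel
    have h2 := torusNorm_add_single_le L (a - y) i
    rw [← key] at h2
    exact ⟨h2.2, h2.1⟩
  · have key : a - y = (b - y) + Pi.single i 1 := by rw [hi]; abel
    have h2 := torusNorm_add_single_le L (b - y) i
    rw [← key] at h2
    exact ⟨h2.1, h2.2⟩

/-- Every site of the torus `(ℤ/Lℤ)^d` has at most `2d` neighbours in the torus graph
(the candidates are `a ± eᵢ`). (Friedli–Velenik 2017, §3.1.) [folklore] -/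
theorem card_filter_torusGraph_adj_le (L : ℕ) [NeZero L] (a : TorusSite d L) :
    #{b : TorusSite d L | (torusGraph d L).Adj a b} ≤ 2 * d := by
  classical
  calc #{b : TorusSite d L | (torusGraph d L).Adj a b}
      ≤ #((univ : Finset (Fin d × Bool)).image fun p =>
          if p.2 then a + Pi.single p.1 1 else a - Pi.single p.1 1) := by
        refine card_le_card fun b hb => ?_
        simp only [mem_filter, mem_univ, true_and] at hb
        rw [torusGraph_adj_iff] at hb
        simp only [mem_image, mem_univ, true_and, Prod.exists]
        rcases hb.2 with ⟨i, hi⟩ | ⟨i, hi⟩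
        · exact ⟨i, true, by simp [hi]⟩
        · exact ⟨i, false, by simp [hi]⟩
    _ ≤ #(univ : Finset (Fin d × Bool)) := card_image_le
    _ = 2 * d := by simp [mul_comm]

/-! ### Counting the spheres of `(ℤ/Lℤ)²` -/

/-- The torus norm on `(ℤ/Lℤ)²` is the larger of the two coordinate terms. [folklore] -/
theorem torusNorm_two_eq_max (L : ℕ) (z : TorusSite 2 L) :
    torusNorm z = max (min (z 0).val (L - (z 0).val)) (min (z 1).val (L - (z 1).val)) := by
  have huniv : (univ : Finset (Fin 2)) = {0, 1} := by ext i; fin_cases i <;> simp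
  simp [torusNorm, huniv]

/-- A coordinate term equal to `r` forces the representative into `{r, L - r}`. [folklore] -/
theorem val_mem_pair_of_min_eq {L r v : ℕ} (hv : v < L) (h : min v (L - v) = r) :
    v ∈ ({r, L - r} : Finset ℕ) := by
  simp only [mem_insert, mem_singleton]
  omega

/-- A coordinate term at most `r` forces the representative into `[0, r] ∪ [L - r, L)`.
[folklore] -/
theorem val_mem_union_of_min_le {L r v : ℕ} (hv : v < L) (h : min v (L - v) ≤ r) :
    v ∈ range (r + 1) ∪ Ico (L - r) L := by
  simp only [mem_union, mem_range, mem_Ico]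
  omega

/-- The `ℓ^∞`-sphere of radius `r` of the two-dimensional torus has at most `4 (2r + 1)` sites
(inject `z ↦ (z₀, z₁)` into `({r, L-r} × ([0,r] ∪ [L-r,L))) ∪ (([0,r] ∪ [L-r,L)) × {r, L-r})`).
(Friedli–Velenik 2017, §3.1.) [folklore] -/
theorem card_filter_torusNorm_eq_le (L : ℕ) [NeZero L] (r : ℕ) :
    #{z : TorusSite 2 L | torusNorm z = r} ≤ 4 * (2 * r + 1) := by
  classical
  set T : Finset ℕ := {r, L - r} with hT
  set S : Finset ℕ := range (r + 1) ∪ Ico (L - r) L with hS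
  have hTc : #T ≤ 2 := card_insert_le _ _
  have hSc : #S ≤ 2 * r + 1 := by
    calc #S ≤ #(range (r + 1)) + #(Ico (L - r) L) := card_union_le _ _
      _ ≤ 2 * r + 1 := by simp only [card_range, Nat.card_Ico]; omega
  calc #{z : TorusSite 2 L | torusNorm z = r}
      ≤ #(T ×ˢ S ∪ S ×ˢ T) := by
        refine card_le_card_of_injOn (fun z => ((z 0).val, (z 1).val)) ?_ ?_
        · intro z hz
          simp only [coe_filter, mem_univ, true_and, Set.mem_setOf_eq] at hz
          rw [torusNorm_two_eq_max] at hz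
          have h0 : (z 0).val < L := ZMod.val_lt _
          have h1 : (z 1).val < L := ZMod.val_lt _
          simp only [coe_union, Set.mem_union, mem_coe, mem_product]
          rcases max_eq_iff.1 hz with ⟨he, hl⟩ | ⟨he, hl⟩
          · exact Or.inl ⟨val_mem_pair_of_min_eq h0 he, val_mem_union_of_min_le h1 (hl.trans he.le)⟩
          · exact Or.inr ⟨val_mem_union_of_min_le h0 (hl.trans he.le), val_mem_pair_of_min_eq h1 he⟩
        · intro z₁ _ z₂ _ h
          simp only [Prod.mk.injEq] at h
          funext i
          fin_cases i
          · exact ZMod.val_injective L h.1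
          · exact ZMod.val_injective L h.2
    _ ≤ #(T ×ˢ S) + #(S ×ˢ T) := card_union_le _ _
    _ ≤ 2 * (2 * r + 1) + (2 * r + 1) * 2 := by
        rw [card_product, card_product]
        gcongr
    _ = 4 * (2 * r + 1) := by ring

/-- The radial sum behind the energy estimate: on `(ℤ/Lℤ)²`,
`Σ_{u : dist(u, y) < D} (dist(u, y) + 1)^{-2} ≤ 8 H(D)` (`H` = harmonic numbers), uniformly in
`L` (shells of radius `r` have `≤ 4(2r+1) ≤ 8(r+1)` sites). (McBryan–Spencer 1977; Koma–Tasaki,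
PRL 68 (1992) 3248, proof of eq. (12).) [folklore] -/
theorem sum_indicator_inv_sq_le (L : ℕ) [NeZero L] (y : TorusSite 2 L) (D : ℕ) :
    ∑ u : TorusSite 2 L,
        (if torusDist u y < D then (((torusDist u y : ℝ) + 1) ^ 2)⁻¹ else 0) ≤
      8 * (harmonic D : ℝ) := by
  classical
  -- translate `u ↦ u - y`
  have htr : ∑ u : TorusSite 2 L,
      (if torusDist u y < D then (((torusDist u y : ℝ) + 1) ^ 2)⁻¹ else 0) =
      ∑ z : TorusSite 2 L, (if torusNorm z < D then (((torusNorm z : ℝ) + 1) ^ 2)⁻¹ else 0) := by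
    simp only [torusDist]
    exact Fintype.sum_equiv (Equiv.subRight y) _ _ fun _ => rfl
  rw [htr]
  -- sum over the shells `torusNorm z = r`, `r ≤ L + D`
  have hmaps : ∀ z ∈ (univ : Finset (TorusSite 2 L)), torusNorm z ∈ range (L + D + 1) := by
    intro z _
    rw [mem_range, torusNorm_two_eq_max]
    have h0 : (z 0).val < L := ZMod.val_lt _
    omega
  rw [← sum_fiberwise_of_maps_to' hmaps
    (fun r : ℕ => if r < D then (((r : ℝ) + 1) ^ 2)⁻¹ else (0 : ℝ))]
  have hshell : ∀ r ∈ range (L + D + 1),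
      ∑ z ∈ (univ : Finset (TorusSite 2 L)) with torusNorm z = r,
          (if r < D then (((r : ℝ) + 1) ^ 2)⁻¹ else (0 : ℝ)) ≤
        if r < D then 8 * ((r : ℝ) + 1)⁻¹ else 0 := by
    intro r _
    rw [sum_const, nsmul_eq_mul]
    split_ifs with hr
    · have hc : (#({z ∈ (univ : Finset (TorusSite 2 L)) | torusNorm z = r}) : ℝ) ≤
          4 * (2 * r + 1) := by exact_mod_cast card_filter_torusNorm_eq_le L r
      have hr0 : (0 : ℝ) < (r : ℝ) + 1 := by positivity
      calc (#({z ∈ (univ : Finset (TorusSite 2 L)) | torusNorm z = r}) : ℝ) * (((r : ℝ) + 1) ^ 2)⁻¹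
          ≤ (4 * (2 * r + 1) : ℝ) * (((r : ℝ) + 1) ^ 2)⁻¹ := by gcongr
        _ ≤ (8 * ((r : ℝ) + 1)) * (((r : ℝ) + 1) ^ 2)⁻¹ :=
            mul_le_mul_of_nonneg_right (by linarith) (by positivity)
        _ = 8 * ((r : ℝ) + 1)⁻¹ := by field_simp
    · simp
  refine (sum_le_sum hshell).trans ?_
  rw [sum_ite, sum_const_zero, add_zero]
  have hfilter : (range (L + D + 1)).filter (fun r => r < D) = range D := by
    ext r
    simp only [mem_filter, mem_range]
    omega
  rw [hfilter, ← mul_sum]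
  gcongr
  simp [harmonic]

/-! ### The elementary `cosh` bound -/

/-- `cosh s - 1 ≤ s²` for `|s| ≤ 1` (from `cosh s ≤ e^{s²/2}` and `e^u - 1 ≤ 2u` on `[0, 1]`).
[folklore] -/
theorem cosh_sub_one_le_sq_of_abs_le_one {s : ℝ} (hs : |s| ≤ 1) : Real.cosh s - 1 ≤ s ^ 2 := by
  have h1 : Real.cosh s ≤ Real.exp (s ^ 2 / 2) := Real.cosh_le_exp_half_sq s
  have hs2 : s ^ 2 ≤ 1 := by
    have := abs_le.1 hs
    nlinarith
  have h2 : |Real.exp (s ^ 2 / 2) - 1| ≤ 2 * |s ^ 2 / 2| :=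
    Real.abs_exp_sub_one_le (by rw [abs_of_nonneg (by positivity)]; linarith)
  rw [abs_of_nonneg (by positivity : (0 : ℝ) ≤ s ^ 2 / 2)] at h2
  have h3 := (abs_le.1 h2).2
  linarith

/-! ### The test potential -/

/-- **The two-dimensional test potential.** For `L ≥ 1`, sites `x, y` of `(ℤ/Lℤ)²` and
`0 ≤ q ≤ 1` there is a real site function `φ` (namely `φ_u = q H(min(dist(u, y), dist(x, y)))`,
`H` the harmonic numbers) with `φ_y = 0`, `φ_x = q H(dist(x, y))` (`≥ q log(1 + dist(x, y))`)
and nearest-neighbour energy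
`Σ_u Σ_v [u ∼ v] 2 (cosh(φ_u - φ_v) - 1) ≤ 128 q² H(dist(x, y))`, uniformly in `L`. This
replaces the lattice Green's function of Koma–Tasaki's eq. (11) (any such test function suffices
for eq. (12)). Koma–Tasaki, PRL 68 (1992) 3248, eqs. (11)–(12); McBryan–Spencer, Commun. Math.
Phys. 53 (1977) 299. [cite: KomaTasakiPRL1992, eqs. (11)–(12)] -/
theorem exists_torusTestPotential (L : ℕ) [NeZero L] (x y : TorusSite 2 L) {q : ℝ}
    (hq0 : 0 ≤ q) (hq1 : q ≤ 1) :
    ∃ φ : TorusSite 2 L → ℝ, φ y = 0 ∧ φ x = q * (harmonic (torusDist x y) : ℝ) ∧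
      ∑ u : TorusSite 2 L, ∑ v : TorusSite 2 L,
          (if (torusGraph 2 L).Adj u v then 2 * (Real.cosh (φ u - φ v) - 1) else 0) ≤
        128 * q ^ 2 * (harmonic (torusDist x y) : ℝ) := by
  classical
  set D : ℕ := torusDist x y with hD
  -- the potential and the majorant of its squared edge differences
  set φ : TorusSite 2 L → ℝ := fun u => q * (harmonic (min (torusDist u y) D) : ℝ) with hφ
  set g : TorusSite 2 L → ℝ := fun u =>
    if torusDist u y < D then (((torusDist u y : ℝ) + 1) ^ 2)⁻¹ else 0 with hg
  have hg0 : ∀ u, 0 ≤ g u := fun u => by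
    simp only [hg]
    split_ifs
    · positivity
    · exact le_rfl
  refine ⟨φ, by simp [hφ], by simp [hφ, hD], ?_⟩
  -- harmonic differences along an edge
  have hharm : ∀ m : ℕ, (harmonic (m + 1) : ℝ) - (harmonic m : ℝ) = ((m : ℝ) + 1)⁻¹ := by
    intro m
    rw [harmonic_succ]
    push_cast
    ring
  -- the edge bound
  have hedge : ∀ u v, (torusGraph 2 L).Adj u v →
      2 * (Real.cosh (φ u - φ v) - 1) ≤ 2 * q ^ 2 * (g u + g v) := by
    intro u v huv
    have hd := torusDist_le_of_adj L huv y
    have hone : ∀ {a b : TorusSite 2 L}, min (torusDist a y) D = min (torusDist b y) D + 1 →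
        2 * (Real.cosh (φ a - φ b) - 1) ≤ 2 * q ^ 2 * g b := by
      intro a b hab
      have hbD : torusDist b y < D := by omega
      have hmb : min (torusDist b y) D = torusDist b y := min_eq_left hbD.le
      have hdiff : φ a - φ b = q * ((torusDist b y : ℝ) + 1)⁻¹ := by
        simp only [hφ]
        rw [hab, ← mul_sub, hharm, hmb]
      have hgb : g b = (((torusDist b y : ℝ) + 1) ^ 2)⁻¹ := by simp only [hg, if_pos hbD]
      have hpos : (0 : ℝ) < (torusDist b y : ℝ) + 1 := by positivity
      have habs : |φ a - φ b| ≤ 1 := by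
        rw [hdiff, abs_of_nonneg (by positivity)]
        calc q * ((torusDist b y : ℝ) + 1)⁻¹ ≤ 1 * 1 := by
              gcongr
              rw [inv_le_one_iff₀]
              right; linarith [show (0 : ℝ) ≤ torusDist b y from Nat.cast_nonneg _]
          _ = 1 := one_mul 1
      have hc := cosh_sub_one_le_sq_of_abs_le_one habs
      rw [hgb]
      calc 2 * (Real.cosh (φ a - φ b) - 1) ≤ 2 * (φ a - φ b) ^ 2 := by linarith
        _ = 2 * q ^ 2 * (((torusDist b y : ℝ) + 1) ^ 2)⁻¹ := by rw [hdiff, mul_pow, inv_pow]; ring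
    rcases Nat.lt_trichotomy (min (torusDist u y) D) (min (torusDist v y) D) with h | h | h
    · -- `m_v = m_u + 1`
      have h' : min (torusDist v y) D = min (torusDist u y) D + 1 := by omega
      have := hone h'
      have hsymm : Real.cosh (φ u - φ v) = Real.cosh (φ v - φ u) := by
        rw [← Real.cosh_neg, neg_sub]
      rw [hsymm]
      have := mul_nonneg (mul_nonneg zero_le_two (sq_nonneg q)) (hg0 v)
      linarith
    · have h0 : φ u - φ v = 0 := by simp only [hφ, h, sub_self]
      rw [h0, Real.cosh_zero, sub_self, mul_zero]
      have := hg0 u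
      have := hg0 v
      positivity
    · have h' : min (torusDist u y) D = min (torusDist v y) D + 1 := by omega
      have := hone h'
      have := mul_nonneg (mul_nonneg zero_le_two (sq_nonneg q)) (hg0 u)
      linarith
  -- summing the edge bound
  have hsum : ∑ u : TorusSite 2 L, ∑ v : TorusSite 2 L,
      (if (torusGraph 2 L).Adj u v then 2 * (Real.cosh (φ u - φ v) - 1) else 0) ≤
      ∑ u : TorusSite 2 L, ∑ v : TorusSite 2 L,
        (if (torusGraph 2 L).Adj u v then 2 * q ^ 2 * (g u + g v) else 0) := by
    refine sum_le_sum fun u _ => sum_le_sum fun v _ => ?_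
    split_ifs with huv
    · exact hedge u v huv
    · exact le_rfl
  refine hsum.trans ?_
  -- symmetrise: `Σ_{u ∼ v} (g u + g v) = 2 Σ_{u ∼ v} g u`
  have hsym : ∑ u : TorusSite 2 L, ∑ v : TorusSite 2 L,
      (if (torusGraph 2 L).Adj u v then 2 * q ^ 2 * (g u + g v) else 0) =
      2 * (2 * q ^ 2) * ∑ u : TorusSite 2 L, ∑ v : TorusSite 2 L,
        (if (torusGraph 2 L).Adj u v then g u else 0) := by
    have hsplit : ∀ u v : TorusSite 2 L,
        (if (torusGraph 2 L).Adj u v then 2 * q ^ 2 * (g u + g v) else 0) =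
        2 * q ^ 2 * (if (torusGraph 2 L).Adj u v then g u else 0) +
          2 * q ^ 2 * (if (torusGraph 2 L).Adj v u then g v else 0) := by
      intro u v
      by_cases huv : (torusGraph 2 L).Adj u v
      · rw [if_pos huv, if_pos huv, if_pos ((torusGraph 2 L).adj_symm huv)]; ring
      · rw [if_neg huv, if_neg huv, if_neg (fun h => huv ((torusGraph 2 L).adj_symm h))]; ring
    simp only [hsplit, sum_add_distrib, ← mul_sum]
    rw [sum_comm (f := fun u v => if (torusGraph 2 L).Adj v u then g v else 0)]
    ring
  rw [hsym]
  -- degree bound: `Σ_v [u ∼ v] g u ≤ 4 g u`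
  have hdeg : ∑ u : TorusSite 2 L, ∑ v : TorusSite 2 L,
      (if (torusGraph 2 L).Adj u v then g u else 0) ≤ ∑ u : TorusSite 2 L, 4 * g u := by
    refine sum_le_sum fun u _ => ?_
    rw [sum_ite, sum_const_zero, add_zero, sum_const, nsmul_eq_mul]
    have hc : (#({v ∈ (univ : Finset (TorusSite 2 L)) | (torusGraph 2 L).Adj u v}) : ℝ) ≤ 4 := by
      exact_mod_cast card_filter_torusGraph_adj_le L u
    exact mul_le_mul_of_nonneg_right hc (hg0 u)
  -- radial sum
  have hrad : ∑ u : TorusSite 2 L, 4 * g u ≤ 4 * (8 * (harmonic D : ℝ)) := by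
    rw [← mul_sum]
    exact mul_le_mul_of_nonneg_left (sum_indicator_inv_sq_le L y D) (by norm_num)
  calc 2 * (2 * q ^ 2) * ∑ u : TorusSite 2 L, ∑ v : TorusSite 2 L,
        (if (torusGraph 2 L).Adj u v then g u else 0)
      ≤ 2 * (2 * q ^ 2) * (4 * (8 * (harmonic D : ℝ))) := by
        gcongr
        exact hdeg.trans hrad
    _ = 128 * q ^ 2 * (harmonic D : ℝ) := by ring

end Literature.MathematicalPhysics.QuantumLattice
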